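import Literature.MathematicalPhysics.QuantumLattice.HubbardFermiSeaTangentRowsDiluteFarPlanes
import Literature.MathematicalPhysics.QuantumLattice.HubbardFermiSeaTangentRowsDiluteFarTPrime
import Summits.Ventures.CertifiedManyBodySolver.Certificates.HubbardSquare_n1o2_farstrip_lower_jensen606_674_649
import Summits.Ventures.CertifiedManyBodySolver.Certificates.HubbardSquare_n7o8_TKT_obliqueStation_splitPlane_r554_r555_r590
import Summits.Ventures.CertifiedManyBodySolver.Certificates.HubbardSquare_n7o8_splitPlaneQ1_byName_readers
import Summits.Ventures.CertifiedManyBodySolver.Certificates.HubbardTTPrime_polarizedBandCaps_kernelB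
import Summits.Ventures.CertifiedManyBodySolver.Observables.PhaseSeparationExclusionBox
import Summits.Ventures.CertifiedManyBodySolver.Observables.PhaseSeparationExclusionBoxGrandCanonicalTcap
import Summits.Ventures.CertifiedManyBodySolver.Observables.PhaseSeparationExclusionBoxLayeredTcap
import Summits.Ventures.CertifiedManyBodySolver.Observables.PhaseSeparationExclusionFarOneSliversB
import Summits.Ventures.CertifiedManyBodySolver.Observables.PhaseSeparationExclusionFarOneYBCO
import Summits.Ventures.CertifiedManyBodySolver.Observables.PhaseSeparationExclusionFarPlanes
import Summits.Ventures.CertifiedManyBodySolver.Observables.PhaseSeparationExclusionFarPlanesBeyondHalf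
import Summits.Ventures.CertifiedManyBodySolver.Observables.PhaseSeparationExclusionHolePlaneCap
import Summits.Ventures.CertifiedManyBodySolver.Observables.PhaseSeparationExclusionMidSegmentCapFarAboveU12
import Summits.Ventures.CertifiedManyBodySolver.Observables.PhaseSeparationExclusionNearStripElectronSideColumnsC
import Summits.Ventures.CertifiedManyBodySolver.Observables.PhaseSeparationExclusionQuarterConvexFloor
import Summits.Ventures.CertifiedManyBodySolver.Observables.PhaseSeparationExclusionSevenEighthsAnchorsLowU
import Summits.Ventures.CertifiedManyBodySolver.Observables.PhaseSeparationExclusionSplitPlaneSevenEighthsCap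
import Summits.Ventures.CertifiedManyBodySolver.Observables.PhaseSeparationExclusionStripPolCaps
import Summits.Ventures.CertifiedManyBodySolver.Observables.PhaseSeparationExclusionVirtualColumns
import HarnessLib
import HarnessLib.Audit

/-!
# Ventures/CertifiedManyBodySolver — Observables/PhaseSeparationExclusionFarPolCVVCAxesME2nP2D.lean: `(≤ 2/5 | ≥ 1)` on segment E2n `t′ ∈ [-1 / 2, -23 / 50] × U ∈ [7 / 2, 16]` — μ axis (`T = 0` gaps `Δμ ≥ G·t`, no `μ` carries both; `T > 0` no `(β, μ)` carries both) and INTERLAYER axis (`T = 0`, every stacking with `(4/π)Σ|t_z| ≤ k·t`) («(2/5∣1) ON THE MAP AXES», g31)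

FAR VIRTUAL-COLUMN edition («THE (8,12) CHORD», hubbard-downfold-unc-2 g40, generator `gen-g40/yb/gen40.py …`): on the far strips the `n = 1` COLUMNS at `U⋆ ∈ {42/5, 17/2, 9, 10, 11}` are now VIRTUAL columns (`vcol_of_laws`, `Observables/PhaseSeparationExclusionVirtualColumns.lean`, g37 device: concavity of `U ↦ e(1,s,U,1)`, the `U`-chord of two LANDED column laws read at `U⋆`) of the `U = 8` law `ext5_n1_col8_m40` ∕ `fp_n1_col8_m65m40` and the `U = 12` law `fp_n1_col12_m50m30` ∕ `fp_n1_col12_m65m50` BY NAME (their producer anchors `hsX8m40n1`, `h428`, `hN12m50`, `hsX12m30n1`, … exactly as printed in those laws): on `[−2/5,−3/10]` the chord reads `−0.5465 ∣ −0.4814` at `(10, s = −2/5 ∣ −3/10)` and `−0.5615 ∣ −0.5471` at `U⋆ = 17/2`, i.e. `0.065–0.093·t` ABOVE the N1-tier point floors `hN10m40`/`hN10m35` (`far_n1_col10_m40m35` −0.6110 ∣ −0.5917, `far_n1_law10`) and the box-eng sheet column `fy1_col17o2_m40m30` (−0.6475 ∣ −0.6402) that every earlier far edition used at `U = 17/2,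 9, 10, 11` — the loosest ingredient of the far words was the `n = 1` column, not the cap: `(≤ 1/2 ∣ ≥ 1)` `T = 0` margins on A2 `[8,10] ∣ [10,12]` 0.033 ∣ 0.036 → 0.077 ∣ 0.074, A1 0.034 → 0.063 ∣ 0.057, E3c 0.036 → 0.056; no new row, no new hypothesis kind. 7/8-WITNESS menu («THE 7/8 WITNESS», hubbard-downfold-unc-2 g40, generator `gen-g40/yb/gen40.py …` over the g39/g38/g31 generators): the CAP menu of every cell now also holds the FOUR `n = 7/8` WITNESS-SPLIT cap planes of the pub/hubbard-fast reuse lane (reader spelling `∀ U s, 0 ≤ U → s ≤ 0 → e(1,s,U,7/8) ≤ T⁺ + D⁺·U + (−B⁺)·s`, cell form `holePlaneUS_tcap_on_cell`, `Observables/PhaseSeparationExclusionSplitPlaneSevenEighthsCap.lean`, this seat g40): the folded-Q1 `(5,7/8,−3/10)` state's plane BY NAME (`n7o8_splitPlaneQ1_of_split hQ1`, node `cert_plaqseam_W4splitQ1_TBD_allmk`, CERTIFIED #693–#695; lowest `7/8` cap for `U ≲ 6.0–6.3`), the #596 `(8,7/8,−3/10)` state's plane BY NAME (`n7o8_splitPlane_of_split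 hS596`, node `cert_plaqseam_W4split596_TBD_allmk`, CERTIFIED #610–#612), the STAGE-2 plane BY VALUE (`hW2m`, R12.52; lowest for `6.3 ≲ U ≲ 8.9–10.5`) and the V18 «WSP7» plane of the CERTIFIED dressed `(12,7/8,−3/10)` strip state BY VALUE (`hW7m`, R12.91 ×3, readers p782947; lowest above) — so the witness filling of a word may be `7/8` (weights `a = (1/8)/(1 − n₁)`, `b = 1 − a`: the dilute floor weighs `1/4` at `n₁ = 1/2` instead of `1/2` with the `3/4` planes), chosen per cell whenever it gives the better word (lower `β₀` ∕ larger margin ∕ stronger axis); every other ingredient as in the g39/g38 editions below. FAR-STRIP QUARTER-FLOOR edition («THE FAR-STRIP QUARTER FLOOR», hubbard-downfold-unc-2 g39, generator `gen-g39/yb/gen39.py far …` over the g38/g31 far-strip generators): the DILUTE FLOOR (`hF₁` slot) of every far cell is the best of (i) the ORACLE DESK's far-strip QUARTER floors — Jensen in `(t′, U)` for the jointly concave `(t′,U) ↦ e` between ONE certified registry row at `(U₁, 1/2, −3/10)` (#674 `U₁ = 10` ∣ #606 `U₁ = 8` ∣ #649 `U₁ = 6`, claim nodes `h674`/`h606`/`h649`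 BY NAME) and the kernel free row at `t′ = −11/20`, then Griffiths monotonicity in `U`: `c₀ + c₁·s ≤ e(1,s,U,1/2)` for `s ∈ [−11/20,−3/10]`, `U ≥ (4s+11/5)·U₁` (`n1o2_farJensen{674,606,649}_strip_of`, `Certificates/HubbardSquare_n1o2_farstrip_lower_jensen606_674_649.lean`, hubbard-fast-surr-4 g10, p775085; `−0.9421 ∣ −0.9300` at `s = −2/5 ∣ −7/20` from #674 vs the FREE sea `−1.0206 ∣ −1.0532`: lifts `+0.078 ∣ +0.123`), used as is for `(≤ 1/2 ∣ ≥ 1)` and EXTRAPOLATED DOWN THE DENSITY by convexity of `n ↦ e` against the cell's best cap at `n₀ > 1/2` (`dilute_floor_of_halfFloor_of_cap`, g35) for `(≤ 9/20 ∣ ≥ 1)` / `(≤ 2/5 ∣ ≥ 1)`, and (ii) the free Fermi-sea `t′`-chord of the earlier editions — whichever gives the better word per cell (named in each docstring). RESULT: the FIRST `(≤ 1/2 ∣ ≥ 1)` words at `t′ < −3/10` (A1 `[−2/5,−7/20]`, A2 `[−7/20,−3/10]`, E3c `[−41/100,−2/5]`, E3 `[−9/20,−2/5]`). V16 FAR-STRIP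 edition («THE #660 PLANE», hubbard-downfold-unc-2 g38, generator `gen-g38/yb/gen38.py far …` over the g31 far-strip generators `gen31_cells.py` / `gen31_axes.py` / the K1 law): CAP per cell = the best of the tree's real-parameter caps on the segment — here almost everywhere the WITNESS-SPLIT PLANE of the CERTIFIED #660 strip state `(8, 3/4, −3/10)` at filling `3/4` (`T⁺ − B⁺·s + D⁺·U`, literals of record `−4440523991983/2⁴² ∣ 214787725653/2⁴⁴ ∣ 91533771269/2⁴²`, sr-mbsolver r211 V16, R12.73-signed; hypothesis `hV16` BY VALUE, cell form `holePlane_tcap_on_cell`, `Observables/PhaseSeparationExclusionHolePlaneCap.lean`; discharged BY NAME by a one-line `wsplit660_capPlane_of h660` the hour lit-4's claim node lands): a `t′ = −3/10` state, `0.05–0.10·t` below the WS597 plane (a `t′ = 0` state) and `0.02–0.07·t` below the kernel polarised caps on `t′ ∈ [−9/20, −3/10]`, `U ∈ [5, 13]`; DILUTE floors = `t′`-chords of the premise-free kernel Fermi-sea tangent rows (free sea; the far strip has no certified quarter-side LOWER); `n = 1` COLUMNS = the landed column laws BY NAME plus VIRTUAL columns (`vcol_of_laws`, `U`-chords of two landed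 laws: `fp_n1_col5_m40m30 ⊕ lowU_n1_law13o2_m40m30` at `U = 141/25, 32/5` on `[−2/5,−3/10]`, `fp_n1_col5_m55p0 ⊕ fp_n1_col8_m65m40` at `U = 141/25, 71/10` on `[−11/20,−2/5]` — the U_min edges 5.64 / 6.4 / 7.1 of the Bi2201 / NaCCOC-x0.20 / CCOC boxes) and gen33's `U = 6` A-segment column `es_n1_law6_m50m30` (BY VALUE `hN6m50`, `hB54`); `T > 0` dilute anchors = kernel free gas `β* = 4` incl. the NEW `n₁ = 9/20` certificates at `t′ = −9/20, −2/5, −7/20` (p767135–p767137, this seat g38). RESULT: `(≤ 9/20 ∣ ≥ 1)` — never typed before on `t′ < −3/10` — holds on A2 `[−7/20,−3/10] × [6, 13]` (margins 0.016–0.053), A1 `[−2/5,−7/20] × [32/5, 13]` (0.029–0.084), E3c `[−41/100,−2/5] × [141/25, 13]` (0.013–0.093), E3/E3s/E3t `× [8, 12]` (0.075–0.085): whole-box for Ca₂₋ₓNaₓCuO₂Cl₂ M36/M58 `[−0.41,−0.3] × [7.1,12.4]` and NaCCOC-x0.20 M57 `[−0.38,−0.27] × [6.4,12.9]`; `(≤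 2/5 ∣ ≥ 1)` NEW down to `U = 5` on A1/A2/E3c (Bi2201 M61/M62 `[−0.411,−0.31] × [5.64,7.27]`, PrSrNiO₂ M39b) and every A-strip threshold re-priced. Theorem names `gv…`/`gw…`. HONEST FRAMING: first certified bounds; not a superconductivity verdict. CLASS = DERIVED / CONTEXT (competing-order words, CONTROL class: the excluded partner phase has
hole doping `≥ 3/5`). PURPOSE: the field / chemical-potential / interlayer ROBUSTNESS annex of the phase maps (D-0098) for the `(≤ 2/5 ∣ ≥ 1)` sentence, which the
T = 0 table (hubbard-box-p3 psbox v1.10) carries on YBCO M18/M130/M64, Bi2212, CCOC, NdNiO₂, Bi2201, CB1 and the La-214 boxes but which had NO axis word anywhere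
(CB1's `T > 0` β ≥ 14 aside). Same column data as the `T > 0` words of `Observables/PhaseSeparationExclusionFarPolCVVCThermalE2D.lean` (this seat g31): CAP per cell = the
best real-parameter cap of the tree (kernel FULLY-POLARISED band caps of hubbard-box-p3 g33, `U`-independent, no claim node; or the WS597 witness-split plane of the
certified #597 state at filling `3/4`, hubbard-box-p3 g34, claim node BY NAME; or kernel HF / registry r468) — named per theorem; `n = 1` COLUMNS = landed laws BY NAME
(producer anchors BY VALUE in each signature: XL n-sheets `hsX…` at `m = 1`, CANDIDATE class where not referee-replayed; N-tier points; registry nodes / K2DIAG bootstraps BY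
NAME); DILUTE floor = the #674-COLUMN floor of `Observables/PhaseSeparationExclusionQuarterConvexFloorB.lean` (quarter rows BY NAME); `T > 0` anchors = kernel free gas `β* = 4` + a-priori `2 log 2` (no thermal claim node). Laws:
`psH_not_fieldGroundState_mix_on_cell_of_columns_tcap` / `psHT_not_fieldEquilibrium_mix_on_cell_of_columns_hotAnchorSS_tcap` (`…BoxZeemanTcap`),
`psGC_gap_on_cell_of_columns_tcap` / `psGCT_not_equilibrium_on_cell_of_columns_hotAnchorSS_tcap` (`…BoxGrandCanonicalTcap`), `psL_not_layeredGroundState_mix_on_cell_of_columns_tcap`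
(`…BoxLayeredTcap`) — this seat g22–g26. Per cell the LARGEST admissible parameter of the menus `h₀ ∈ {1/4 … 1/40}`, `G ∈ {5/4 … 1/20}`, `k ∈ {3/20 … 1/40}` is stated
(cost `h₀·n̄`, `G·a·b·(1−n₁)`, `k` against the exact `T = 0` column margins; kernel re-check by `nlinarith`). Cells: `[7 / 2,4]` ∣ `[4,9 / 2]` ∣ `[9 / 2,5]` ∣ `[5,6]` ∣ `[6,8]` ∣ `[8,10]` ∣ `[10,12]` ∣ `[12,13]` ∣ `[13,16]`.
WHAT THIS IS NOT: a certificate or number of record; CONTROL-class words conditional BY NAME / BY VALUE on the premises printed in each signature; field / grand-canonical /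
layered ground states and equilibria as variational notions (existence not claimed); `κ = (4/π)Σ|t_z|` is the crude linear interlayer cost; nothing about stripes as states,
ferromagnetism, superconductivity or `T_c`.

Seat hubbard-downfold-unc-2 g31; generator `pub/hubbard-downfold/hubbard-downfold-unc-2/gen-g31/yb/gen31_axes.py` (= g30's gen30_axes.py over the g31 cell tables).
[cite: Israel1979, Thm. I.2.4] [cite: LiebPRL1989, proof of Theorem 1] [cite: PoulinHastings2011, eqs. (3)–(8)] [cite: Griffiths1964, §II] [cite: Israel1979, Thm. I.2.4] [cite: EmeryKivelsonLin1990, pp. 475–476] [cite: Ruelle1969, §3.3] [cite: BratteliKishimotoRobinson1978, Thm. 2 (condition 2)] [cite: BachLiebSolovej1994, eq. (2c.36)] [cite: LiebLoss1993, §8, Theorem 8.2]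
-/

noncomputable section

namespace Summit.Ventures.CertifiedManyBodySolver.Observables

open Summit.Ventures.CertifiedManyBodySolver.Certificates Summit.Ventures.CertifiedManyBodySolver.Downfold
open Literature.MathematicalPhysics.QuantumLattice Literature.MathematicalPhysics.QuantumLattice.ThermodynamicLimit
open Literature.MathematicalPhysics.QuantumLattice.InfVolFermionState Set Filter
open Literature.Probability.LatticeModels HubbardWave0
open scoped BigOperators

/-- **`Δμ ≥ 5/4·t` on segment E2n `t′ ∈ [-1 / 2, -23 / 50] × U ∈ [12, 13]`, `T = 0`** (`(≤ 2/5 | ≥ 1)`; cap = the PROVED kernel FULLY-POLARISED band cap `pol5o8_m50m45` (one spin species at density `5 / 8`, `U`-independent; no claim node) at filling `5 / 8`;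
columns `fp_n1_col12_m50m45` ∣ `fp_n1_col12_up13_m50m35`): between any `μ₁` carrying a `≤ 2/5`-filled and any `μ₂` carrying a `≥ 1`-filled translation-invariant ground state of `H(1,s,U) − μN`
(`g = 45/256 ≤` every column margin: `U = 12`: M 0.2240∣0.2060; `U = 13`: M 0.2240∣0.2059; `a·b·(1−n₁) = 9/64`). [cite: Israel1979, Thm. I.2.4] [cite: EmeryKivelsonLin1990, pp. 475–476] [cite: Ruelle1969, §3.3] -/
theorem waG_2o5_E2n_12to13_gap5o4 (hN12m50 : ((-5556605539/10000000000 : ℚ) : ℝ) ≤ energyDensityTT' 1 (-1 / 2) 12 1) (hN12m45 : ((-2684470593/5000000000 : ℚ) : ℝ) ≤ energyDensityTT' 1 (-9 / 20) 12 1) (hN12m35 : ((-5005862527/10000000000 : ℚ) : ℝ) ≤ energyDensityTT' 1 (-7 / 20) 12 1)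
    {s : ℝ} (hs : s ∈ Icc (-1 / 2 : ℝ) (-23 / 50)) {U : ℝ} (hU : U ∈ Icc (12 : ℝ) (13))
    {μ₁ μ₂ : ℝ} {ω₁ ω₂ : InfVolFermionState 2}
    (hω₁ : ω₁.IsMeanEnergyMinimiser (hubbardTTPrimeMuInteraction 1 s U μ₁) 1) (hρ₁ : ω₁.density ≤ 2 / 5)
    (hω₂ : ω₂.IsMeanEnergyMinimiser (hubbardTTPrimeMuInteraction 1 s U μ₂) 1) (hρ₂ : 1 ≤ ω₂.density) :
    (5 / 4 : ℝ) ≤ μ₂ - μ₁ := by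
  have k := psGC_gap_on_cell_of_columns_tcap 1 (s₁ := -1 / 2) (s₂ := -23 / 50) (U₁ := 12) (U₂ := 13)
    (n₁ := 2 / 5) (n₂ := 1) (a := 5 / 8) (b := 3 / 8) (c₀ := ((-7676351/10000000 : ℚ) : ℝ)) (cs := ((3172909/10000000 : ℚ) : ℝ)) (c₁ := ((0 : ℚ) : ℝ)) (g := 45 / 256)
    (by norm_num) (by norm_num) (by norm_num) (by norm_num) (by norm_num) (by norm_num) (by norm_num) (by norm_num)
    (pol5o8_m50m45_tcap_on_cell (by norm_num) (by norm_num) (by norm_num) (by norm_num))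
    (fun s hs => fp_n1_col12_m50m45 hN12m50 hN12m45 s ⟨hs.1.trans' (by norm_num), hs.2.trans (by norm_num)⟩)
    (fun s hs => fp_n1_col12_up13_m50m35 hN12m50 hN12m35 s ⟨hs.1.trans' (by norm_num), hs.2.trans (by norm_num)⟩)
    (fun s hs U hU => floor_on_cell_of_tPrime_end_rows 1 (n := 2 / 5) (by norm_num) (by norm_num) (by norm_num)
      (fun _ hU' => fermiSeaTangentRow_tPrime_neg_one_div_two_at_two_div_five hU' (by norm_num) (by norm_num)) (fun _ hU' => fermiSeaTangentRow_tPrime_neg_nine_div_twenty_at_two_div_five hU' (by norm_num) (by norm_num)) s ⟨hs.1.trans' (by norm_num), hs.2.trans (by norm_num)⟩ U (by linarith [hU.1]))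
    ?_ ?_ hs hU hω₁ (meanEnergy_hubbardTTPrimeMu_eq_sub 1 s U μ₁) hω₂ (meanEnergy_hubbardTTPrimeMu_eq_sub 1 s U μ₂) hρ₁ hρ₂
  · linarith
  · intro s hs; obtain ⟨h1, h2⟩ := hs; push_cast; norm_num; nlinarith [h1, h2]
  · intro s hs; obtain ⟨h1, h2⟩ := hs; push_cast; norm_num; nlinarith [h1, h2]

/-- **No `μ` carries both** a `≤ 2/5`-filled and a `≥ 1`-filled translation-invariant ground state of `H(1,s,U) − μN`, for every `(s, U)` of segment E2n
`[-1 / 2, -23 / 50] × [12, 13]` (`T = 0`; `n(μ)` never jumps from `≤ 2/5` to `≥ 1`; from `waG_2o5_E2n_12to13_gap5o4`). [cite: Israel1979, Thm. I.2.4] [cite: EmeryKivelsonLin1990, pp. 475–476] [cite: Ruelle1969, §3.3] -/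
theorem waG_2o5_E2n_12to13_noMu (hN12m50 : ((-5556605539/10000000000 : ℚ) : ℝ) ≤ energyDensityTT' 1 (-1 / 2) 12 1) (hN12m45 : ((-2684470593/5000000000 : ℚ) : ℝ) ≤ energyDensityTT' 1 (-9 / 20) 12 1) (hN12m35 : ((-5005862527/10000000000 : ℚ) : ℝ) ≤ energyDensityTT' 1 (-7 / 20) 12 1)
    {s : ℝ} (hs : s ∈ Icc (-1 / 2 : ℝ) (-23 / 50)) {U : ℝ} (hU : U ∈ Icc (12 : ℝ) (13))
    {μ : ℝ} {ω₁ ω₂ : InfVolFermionState 2} (hω₁ : ω₁.IsMeanEnergyMinimiser (hubbardTTPrimeMuInteraction 1 s U μ) 1)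
    (hρ₁ : ω₁.density ≤ 2 / 5) (hρ₂ : 1 ≤ ω₂.density) :
    ¬ ω₂.IsMeanEnergyMinimiser (hubbardTTPrimeMuInteraction 1 s U μ) 1 := by
  intro hω₂
  have h := waG_2o5_E2n_12to13_gap5o4 hN12m50 hN12m45 hN12m35 hs hU hω₁ hρ₁ hω₂ hρ₂
  norm_num at h

/-- **`(≤ 2/5 | ≥ 1)` IN THE 3D LAYERED CRYSTAL, `T = 0`: segment E2n `t′ ∈ [-1 / 2, -23 / 50] × U ∈ [12, 13]`, every stacking with `(4/π)Σ_b|t_z,b| ≤ 3/20·t`**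
(column margins `U = 12`: M 0.2240∣0.2060; `U = 13`: M 0.2240∣0.2059 minus the interlayer cost `0.15`; cap = the PROVED kernel FULLY-POLARISED band cap `pol5o8_m50m45` (one spin species at density `5 / 8`, `U`-independent; no claim node) at filling `5 / 8`; columns `fp_n1_col12_m50m45` ∣ `fp_n1_col12_up13_m50m35`): no `(≤ 2/5 ∣ ≥ 1)` mixture of
translation-invariant states on `ℤ³` is a ground state of `layeredHubbardTTPrime 1 s U w tz` at its filling. [cite: Israel1979, Thm. I.2.4] [cite: BratteliKishimotoRobinson1978, Thm. 2 (condition 2)] -/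
theorem waL_2o5_E2n_12to13_k3o20 (hN12m50 : ((-5556605539/10000000000 : ℚ) : ℝ) ≤ energyDensityTT' 1 (-1 / 2) 12 1) (hN12m45 : ((-2684470593/5000000000 : ℚ) : ℝ) ≤ energyDensityTT' 1 (-9 / 20) 12 1) (hN12m35 : ((-5005862527/10000000000 : ℚ) : ℝ) ≤ energyDensityTT' 1 (-7 / 20) 12 1)
    {s : ℝ} (hs : s ∈ Icc (-1 / 2 : ℝ) (-23 / 50)) {U : ℝ} (hU : U ∈ Icc (12 : ℝ) (13))
    {κ : Type*} [Fintype κ] {w : κ → Site 3} (hw : ∀ b, w b 0 ≠ 0) {tz : κ → ℝ} {R' : ℝ} (hR' : 1 ≤ R')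
    (hwR' : ∀ b, w b ∈ thicken ({0} : Finset (Site 3)) R') (hk : 4 / Real.pi * ∑ b, |tz b| ≤ 3 / 20)
    {ω₁ ω₂ : InfVolFermionState 3} (h₁ : ω₁.IsTranslationInvariant) (h₂ : ω₂.IsTranslationInvariant)
    (hρ₁ : 0 < ω₁.density) (hρ₁' : ω₁.density ≤ 2 / 5) (hρ₂ : 1 ≤ ω₂.density) (hρ₂' : ω₂.density < 2)
    {lam : ℝ} (hl0 : 0 < lam) (hl1 : lam < 1) :
    (layeredHubbardTTPrime 1 s U w tz).tiGroundEnergyDensityAt R' (mix lam hl0.le hl1.le ω₁ ω₂).density <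
      (mix lam hl0.le hl1.le ω₁ ω₂).meanEnergy (layeredHubbardTTPrime 1 s U w tz) R' := by
  refine psL_not_layeredGroundState_mix_on_cell_of_columns_tcap 1 hw tz hR' hwR' (s₁ := -1 / 2) (s₂ := -23 / 50) (U₁ := 12) (U₂ := 13)
    (n₁ := 2 / 5) (n₂ := 1) (a := 5 / 8) (b := 3 / 8) (c₀ := ((-7676351/10000000 : ℚ) : ℝ)) (cs := ((3172909/10000000 : ℚ) : ℝ)) (c₁ := ((0 : ℚ) : ℝ)) (k := 3 / 20)
    (by norm_num) (by norm_num) (by norm_num) (by norm_num) (by norm_num) (by norm_num) (by norm_num) (by norm_num)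
    (pol5o8_m50m45_tcap_on_cell (by norm_num) (by norm_num) (by norm_num) (by norm_num))
    (fun s hs => fp_n1_col12_m50m45 hN12m50 hN12m45 s ⟨hs.1.trans' (by norm_num), hs.2.trans (by norm_num)⟩)
    (fun s hs => fp_n1_col12_up13_m50m35 hN12m50 hN12m35 s ⟨hs.1.trans' (by norm_num), hs.2.trans (by norm_num)⟩)
    (fun s hs U hU => floor_on_cell_of_tPrime_end_rows 1 (n := 2 / 5) (by norm_num) (by norm_num) (by norm_num)
      (fun _ hU' => fermiSeaTangentRow_tPrime_neg_one_div_two_at_two_div_five hU' (by norm_num) (by norm_num)) (fun _ hU' => fermiSeaTangentRow_tPrime_neg_nine_div_twenty_at_two_div_five hU' (by norm_num) (by norm_num)) s ⟨hs.1.trans' (by norm_num), hs.2.trans (by norm_num)⟩ U (by linarith [hU.1]))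
    hk ?_ ?_ hs hU h₁ h₂ hρ₁ hρ₁' hρ₂ hρ₂' hl0 hl1
  · intro s hs; obtain ⟨h1, h2⟩ := hs; push_cast; norm_num; nlinarith [h1, h2]
  · intro s hs; obtain ⟨h1, h2⟩ := hs; push_cast; norm_num; nlinarith [h1, h2]

/-- **`Δμ ≥ 1·t` on segment E2n `t′ ∈ [-1 / 2, -23 / 50] × U ∈ [13, 16]`, `T = 0`** (`(≤ 2/5 | ≥ 1)`; cap = the PROVED kernel FULLY-POLARISED band cap `pol5o8_m50m45` (one spin species at density `5 / 8`, `U`-independent; no claim node) at filling `5 / 8`;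
columns `fp_n1_col12_up13_m50m35` ∣ `fy1_kin16_m65m30`): between any `μ₁` carrying a `≤ 2/5`-filled and any `μ₂` carrying a `≥ 1`-filled translation-invariant ground state of `H(1,s,U) − μN`
(`g = 9/64 ≤` every column margin: `U = 13`: M 0.2240∣0.2059; `U = 16`: M 0.1747∣0.1753; `a·b·(1−n₁) = 9/64`). [cite: Israel1979, Thm. I.2.4] [cite: EmeryKivelsonLin1990, pp. 475–476] [cite: Ruelle1969, §3.3] -/
theorem waG_2o5_E2n_13to16_gap1 (hN12m50 : ((-5556605539/10000000000 : ℚ) : ℝ) ≤ energyDensityTT' 1 (-1 / 2) 12 1) (hN12m35 : ((-5005862527/10000000000 : ℚ) : ℝ) ≤ energyDensityTT' 1 (-7 / 20) 12 1) (hX16m30 : ((-453707447/1250000000 : ℚ) : ℝ) ≤ energyDensityTT' 1 (-3 / 10) 16 1)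
    {s : ℝ} (hs : s ∈ Icc (-1 / 2 : ℝ) (-23 / 50)) {U : ℝ} (hU : U ∈ Icc (13 : ℝ) (16))
    {μ₁ μ₂ : ℝ} {ω₁ ω₂ : InfVolFermionState 2}
    (hω₁ : ω₁.IsMeanEnergyMinimiser (hubbardTTPrimeMuInteraction 1 s U μ₁) 1) (hρ₁ : ω₁.density ≤ 2 / 5)
    (hω₂ : ω₂.IsMeanEnergyMinimiser (hubbardTTPrimeMuInteraction 1 s U μ₂) 1) (hρ₂ : 1 ≤ ω₂.density) :
    (1 : ℝ) ≤ μ₂ - μ₁ := by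
  have k := psGC_gap_on_cell_of_columns_tcap 1 (s₁ := -1 / 2) (s₂ := -23 / 50) (U₁ := 13) (U₂ := 16)
    (n₁ := 2 / 5) (n₂ := 1) (a := 5 / 8) (b := 3 / 8) (c₀ := ((-7676351/10000000 : ℚ) : ℝ)) (cs := ((3172909/10000000 : ℚ) : ℝ)) (c₁ := ((0 : ℚ) : ℝ)) (g := 9 / 64)
    (by norm_num) (by norm_num) (by norm_num) (by norm_num) (by norm_num) (by norm_num) (by norm_num) (by norm_num)
    (pol5o8_m50m45_tcap_on_cell (by norm_num) (by norm_num) (by norm_num) (by norm_num))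
    (fun s hs => fp_n1_col12_up13_m50m35 hN12m50 hN12m35 s ⟨hs.1.trans' (by norm_num), hs.2.trans (by norm_num)⟩)
    (fun s hs => fy1_kin16_m65m30 hX16m30 s ⟨hs.1.trans' (by norm_num), hs.2.trans (by norm_num)⟩)
    (fun s hs U hU => floor_on_cell_of_tPrime_end_rows 1 (n := 2 / 5) (by norm_num) (by norm_num) (by norm_num)
      (fun _ hU' => fermiSeaTangentRow_tPrime_neg_one_div_two_at_two_div_five hU' (by norm_num) (by norm_num)) (fun _ hU' => fermiSeaTangentRow_tPrime_neg_nine_div_twenty_at_two_div_five hU' (by norm_num) (by norm_num)) s ⟨hs.1.trans' (by norm_num), hs.2.trans (by norm_num)⟩ U (by linarith [hU.1]))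
    ?_ ?_ hs hU hω₁ (meanEnergy_hubbardTTPrimeMu_eq_sub 1 s U μ₁) hω₂ (meanEnergy_hubbardTTPrimeMu_eq_sub 1 s U μ₂) hρ₁ hρ₂
  · linarith
  · intro s hs; obtain ⟨h1, h2⟩ := hs; push_cast; norm_num; nlinarith [h1, h2]
  · intro s hs; obtain ⟨h1, h2⟩ := hs; push_cast; norm_num; nlinarith [h1, h2]

/-- **No `μ` carries both** a `≤ 2/5`-filled and a `≥ 1`-filled translation-invariant ground state of `H(1,s,U) − μN`, for every `(s, U)` of segment E2n
`[-1 / 2, -23 / 50] × [13, 16]` (`T = 0`; `n(μ)` never jumps from `≤ 2/5` to `≥ 1`; from `waG_2o5_E2n_13to16_gap1`). [cite: Israel1979, Thm. I.2.4] [cite: EmeryKivelsonLin1990, pp. 475–476] [cite: Ruelle1969, §3.3] -/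
theorem waG_2o5_E2n_13to16_noMu (hN12m50 : ((-5556605539/10000000000 : ℚ) : ℝ) ≤ energyDensityTT' 1 (-1 / 2) 12 1) (hN12m35 : ((-5005862527/10000000000 : ℚ) : ℝ) ≤ energyDensityTT' 1 (-7 / 20) 12 1) (hX16m30 : ((-453707447/1250000000 : ℚ) : ℝ) ≤ energyDensityTT' 1 (-3 / 10) 16 1)
    {s : ℝ} (hs : s ∈ Icc (-1 / 2 : ℝ) (-23 / 50)) {U : ℝ} (hU : U ∈ Icc (13 : ℝ) (16))
    {μ : ℝ} {ω₁ ω₂ : InfVolFermionState 2} (hω₁ : ω₁.IsMeanEnergyMinimiser (hubbardTTPrimeMuInteraction 1 s U μ) 1)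
    (hρ₁ : ω₁.density ≤ 2 / 5) (hρ₂ : 1 ≤ ω₂.density) :
    ¬ ω₂.IsMeanEnergyMinimiser (hubbardTTPrimeMuInteraction 1 s U μ) 1 := by
  intro hω₂
  have h := waG_2o5_E2n_13to16_gap1 hN12m50 hN12m35 hX16m30 hs hU hω₁ hρ₁ hω₂ hρ₂
  norm_num at h

/-- **`(≤ 2/5 | ≥ 1)` IN THE 3D LAYERED CRYSTAL, `T = 0`: segment E2n `t′ ∈ [-1 / 2, -23 / 50] × U ∈ [13, 16]`, every stacking with `(4/π)Σ_b|t_z,b| ≤ 3/20·t`**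
(column margins `U = 13`: M 0.2240∣0.2059; `U = 16`: M 0.1747∣0.1753 minus the interlayer cost `0.15`; cap = the PROVED kernel FULLY-POLARISED band cap `pol5o8_m50m45` (one spin species at density `5 / 8`, `U`-independent; no claim node) at filling `5 / 8`; columns `fp_n1_col12_up13_m50m35` ∣ `fy1_kin16_m65m30`): no `(≤ 2/5 ∣ ≥ 1)` mixture of
translation-invariant states on `ℤ³` is a ground state of `layeredHubbardTTPrime 1 s U w tz` at its filling. [cite: Israel1979, Thm. I.2.4] [cite: BratteliKishimotoRobinson1978, Thm. 2 (condition 2)] -/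
theorem waL_2o5_E2n_13to16_k3o20 (hN12m50 : ((-5556605539/10000000000 : ℚ) : ℝ) ≤ energyDensityTT' 1 (-1 / 2) 12 1) (hN12m35 : ((-5005862527/10000000000 : ℚ) : ℝ) ≤ energyDensityTT' 1 (-7 / 20) 12 1) (hX16m30 : ((-453707447/1250000000 : ℚ) : ℝ) ≤ energyDensityTT' 1 (-3 / 10) 16 1)
    {s : ℝ} (hs : s ∈ Icc (-1 / 2 : ℝ) (-23 / 50)) {U : ℝ} (hU : U ∈ Icc (13 : ℝ) (16))
    {κ : Type*} [Fintype κ] {w : κ → Site 3} (hw : ∀ b, w b 0 ≠ 0) {tz : κ → ℝ} {R' : ℝ} (hR' : 1 ≤ R')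
    (hwR' : ∀ b, w b ∈ thicken ({0} : Finset (Site 3)) R') (hk : 4 / Real.pi * ∑ b, |tz b| ≤ 3 / 20)
    {ω₁ ω₂ : InfVolFermionState 3} (h₁ : ω₁.IsTranslationInvariant) (h₂ : ω₂.IsTranslationInvariant)
    (hρ₁ : 0 < ω₁.density) (hρ₁' : ω₁.density ≤ 2 / 5) (hρ₂ : 1 ≤ ω₂.density) (hρ₂' : ω₂.density < 2)
    {lam : ℝ} (hl0 : 0 < lam) (hl1 : lam < 1) :
    (layeredHubbardTTPrime 1 s U w tz).tiGroundEnergyDensityAt R' (mix lam hl0.le hl1.le ω₁ ω₂).density <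
      (mix lam hl0.le hl1.le ω₁ ω₂).meanEnergy (layeredHubbardTTPrime 1 s U w tz) R' := by
  refine psL_not_layeredGroundState_mix_on_cell_of_columns_tcap 1 hw tz hR' hwR' (s₁ := -1 / 2) (s₂ := -23 / 50) (U₁ := 13) (U₂ := 16)
    (n₁ := 2 / 5) (n₂ := 1) (a := 5 / 8) (b := 3 / 8) (c₀ := ((-7676351/10000000 : ℚ) : ℝ)) (cs := ((3172909/10000000 : ℚ) : ℝ)) (c₁ := ((0 : ℚ) : ℝ)) (k := 3 / 20)
    (by norm_num) (by norm_num) (by norm_num) (by norm_num) (by norm_num) (by norm_num) (by norm_num) (by norm_num)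
    (pol5o8_m50m45_tcap_on_cell (by norm_num) (by norm_num) (by norm_num) (by norm_num))
    (fun s hs => fp_n1_col12_up13_m50m35 hN12m50 hN12m35 s ⟨hs.1.trans' (by norm_num), hs.2.trans (by norm_num)⟩)
    (fun s hs => fy1_kin16_m65m30 hX16m30 s ⟨hs.1.trans' (by norm_num), hs.2.trans (by norm_num)⟩)
    (fun s hs U hU => floor_on_cell_of_tPrime_end_rows 1 (n := 2 / 5) (by norm_num) (by norm_num) (by norm_num)
      (fun _ hU' => fermiSeaTangentRow_tPrime_neg_one_div_two_at_two_div_five hU' (by norm_num) (by norm_num)) (fun _ hU' => fermiSeaTangentRow_tPrime_neg_nine_div_twenty_at_two_div_five hU' (by norm_num) (by norm_num)) s ⟨hs.1.trans' (by norm_num), hs.2.trans (by norm_num)⟩ U (by linarith [hU.1]))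
    hk ?_ ?_ hs hU h₁ h₂ hρ₁ hρ₁' hρ₂ hρ₂' hl0 hl1
  · intro s hs; obtain ⟨h1, h2⟩ := hs; push_cast; norm_num; nlinarith [h1, h2]
  · intro s hs; obtain ⟨h1, h2⟩ := hs; push_cast; norm_num; nlinarith [h1, h2]

end Summit.Ventures.CertifiedManyBodySolver.Observables
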